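import Summits.Ventures.HSemireg.Mod4SiteMiddleModelU
import Summits.Ventures.HSemireg.Mod4SiteTagsG

/-!
# Venture HSemireg — MOD-4 line: the selection words span the pair-free block forms; the decomposition of `⋀ⁿ`
# (th-7's Weil model of type `(n,n)`; bookkeeping for the assembly of THEOREM R_f's middle degree)

HONEST FRAMING. Part of the Lean index of the computation cell `pub-hsemireg` (widening group W3, seat w3-mod4-1 gen 5; files
of record `HOME/widen/W3/MOD4-OFFSPLIT-w3mod4.md` §10.2 / §11).  Finite-dimensional exterior algebra over a field ONLY (th-7's wedge
model): no abelian variety, no sheaf, no Ext group, no semiregularity map; nothing here says that HC, HC_CM or HC_AV holds; no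
Literature fact is declared or used; THEOREM R_f is NOT asserted here.  WHAT IS PROVED (bookkeeping of the proof sheet §3′/§4):
* `Sp_or`, `Sp_congr_iff` — spans of basis monomials over a disjunction / equivalent predicates;
* `span_wordsD_eq_Sp`, `span_wordsG_eq_Sp` — the `2ⁿ` selection words `μ_B` (resp. `μ′_{B′}`) SPAN exactly the span of the
  pair-free block-`D` (resp. block-`G`) basis `n`-monomials (they are non-zero multiples of distinct such monomials and the
  dimensions agree: `Mod4Site.card_selD` / `card_selG`);
* `Hom_middle_eq_sup` — `⋀ⁿ = Mm_n ⊔ (pair-D forms ⊔ (pair-G forms ⊔ (selection-D forms ⊔ selection-G forms)))`, the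
  decomposition of the degree-`n` forms by support type used in the proof sheet §3′.
All statements and proofs: w3-mod4-1 g5 (2026-08-23).  Namespace `Summit.Ventures.HSemireg.Mod4Site`.
-/

namespace Summit.Ventures.HSemireg.Mod4Site

open ExteriorAlgebra Summit.Ventures.HSemireg.Wedge Summit.Ventures.HSemireg.Wedge.Hankel Summit.Ventures.HSemireg.Wedge.Weil

variable {K : Type*} [Field K]

/-! ### §1 Spans of basis monomials: disjunctions and equivalent predicates -/

section SpLemmas

variable {I : Type*} [LinearOrder I] [Fintype I]

/-- `Sp(P ∨ Q) = Sp P ⊔ Sp Q`. -/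
lemma Sp_or (P Q : Finset I → Prop) : Sp K (fun s => P s ∨ Q s) = Sp K P ⊔ Sp K Q := by
  rw [Sp, Sp, Sp, Set.setOf_or, Set.image_union, Submodule.span_union]

/-- equivalent predicates have the same span. -/
lemma Sp_congr_iff {P Q : Finset I → Prop} (h : ∀ s, P s ↔ Q s) : Sp K P = Sp K Q := by
  have : P = Q := funext fun s => propext (h s)
  rw [this]

end SpLemmas

variable {n : ℕ}

/-! ### §2 The selection words span the pair-free block forms -/

/-- the letter set of `μ_B` is a pair-free block-`D` `n`-set. -/
lemma letterD_selD (S : Finset (Fin n)) :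
    (Finset.univ.image fun k : Fin n => if k ∈ S then yJ (n + n) (Fin.castAdd n k) else xJ (n + n) (Fin.castAdd n k)) ⊆
        Dm (n + n) n ∧
      (Finset.univ.image fun k : Fin n => if k ∈ S then yJ (n + n) (Fin.castAdd n k) else xJ (n + n) (Fin.castAdd n k)).card = n ∧
      ¬ ∃ i ∈ (Finset.univ.image fun k : Fin n => if k ∈ S then yJ (n + n) (Fin.castAdd n k) else xJ (n + n) (Fin.castAdd n k)),
        pt i ∈ (Finset.univ.image fun k : Fin n => if k ∈ S then yJ (n + n) (Fin.castAdd n k) else xJ (n + n) (Fin.castAdd n k)) := by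
  refine ⟨letterD_subset_Dm S, ?_, ?_⟩
  · rw [Finset.card_image_of_injective _ (letterD_injective n S), Finset.card_univ, Fintype.card_fin]
  · rintro ⟨i, hi, hpi⟩
    obtain ⟨k, -, rfl⟩ := Finset.mem_image.mp hi
    obtain ⟨k', -, hk'⟩ := Finset.mem_image.mp hpi
    have hkk : k' = k := by
      have := congrArg pr hk'
      simp only [apply_ite pr, pr_xJ, pr_yJ, ite_self, pr_pt] at this
      exact Fin.castAdd_injective _ _ this
    subst hkk
    exact pt_ne_self _ hk'.symm

/-- the letter set of `μ′_{B′}` is a pair-free block-`G` `n`-set. -/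
lemma letterG_selG (S : Finset (Fin n)) :
    (Finset.univ.image fun k : Fin n => if k ∈ S then yJ (n + n) (Fin.natAdd n k) else xJ (n + n) (Fin.natAdd n k)) ⊆
        Gm (n + n) n ∧
      (Finset.univ.image fun k : Fin n => if k ∈ S then yJ (n + n) (Fin.natAdd n k) else xJ (n + n) (Fin.natAdd n k)).card = n ∧
      ¬ ∃ i ∈ (Finset.univ.image fun k : Fin n => if k ∈ S then yJ (n + n) (Fin.natAdd n k) else xJ (n + n) (Fin.natAdd n k)),
        pt i ∈ (Finset.univ.image fun k : Fin n => if k ∈ S then yJ (n + n) (Fin.natAdd n k) else xJ (n + n) (Fin.natAdd n k)) := by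
  refine ⟨letterG_subset_Gm S, ?_, ?_⟩
  · rw [Finset.card_image_of_injective _ (letterG_injective n S), Finset.card_univ, Fintype.card_fin]
  · rintro ⟨i, hi, hpi⟩
    obtain ⟨k, -, rfl⟩ := Finset.mem_image.mp hi
    obtain ⟨k', -, hk'⟩ := Finset.mem_image.mp hpi
    have hkk : k' = k := by
      have := congrArg pr hk'
      simp only [apply_ite pr, pr_xJ, pr_yJ, ite_self, pr_pt] at this
      exact Fin.natAdd_injective _ _ this
    subst hkk
    exact pt_ne_self _ hk'.symm

/-- the selection words `μ_B` are linearly independent. -/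
lemma linearIndependent_wordsD :
    LinearIndependent K (fun S : Finset (Fin n) => (List.ofFn fun k : Fin n =>
      ι K (if k ∈ S then b K (In (n + n)) (yJ (n + n) (Fin.castAdd n k)) else b K (In (n + n)) (xJ (n + n) (Fin.castAdd n k)))).prod) := by
  classical
  choose c hc hc' using fun S : Finset (Fin n) => wordP_eq_smul_B (K := K) S
  have hinj : Function.Injective (fun S : Finset (Fin n) => Finset.univ.image fun k : Fin n =>
      if k ∈ S then yJ (n + n) (Fin.castAdd n k) else xJ (n + n) (Fin.castAdd n k)) := by
    intro S₁ S₂ h; ext k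
    have e := congrArg (fun T => yJ (n + n) (Fin.castAdd n k) ∈ T) h
    simp only [yJ_mem_letterD, eq_iff_iff] at e
    exact e
  have hB := ((B K (In (n + n))).linearIndependent.comp _ hinj).units_smul (fun S => Units.mk0 (c S) (hc S))
  convert hB using 1
  funext S
  simp only [Pi.smul_apply', Units.smul_mk0, Function.comp_apply]
  exact hc' S

/-- the selection words `μ′_{B′}` are linearly independent. -/
lemma linearIndependent_wordsG :
    LinearIndependent K (fun S : Finset (Fin n) => (List.ofFn fun k : Fin n =>
      ι K (if k ∈ S then b K (In (n + n)) (yJ (n + n) (Fin.natAdd n k)) else b K (In (n + n)) (xJ (n + n) (Fin.natAdd n k)))).prod) := by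
  classical
  choose c hc hc' using fun S : Finset (Fin n) => wordQ_eq_smul_B (K := K) S
  have hinj : Function.Injective (fun S : Finset (Fin n) => Finset.univ.image fun k : Fin n =>
      if k ∈ S then yJ (n + n) (Fin.natAdd n k) else xJ (n + n) (Fin.natAdd n k)) := by
    intro S₁ S₂ h; ext k
    have e := congrArg (fun T => yJ (n + n) (Fin.natAdd n k) ∈ T) h
    simp only [yJ_mem_letterG, eq_iff_iff] at e
    exact e
  have hB := ((B K (In (n + n))).linearIndependent.comp _ hinj).units_smul (fun S => Units.mk0 (c S) (hc S))
  convert hB using 1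
  funext S
  simp only [Pi.smul_apply', Units.smul_mk0, Function.comp_apply]
  exact hc' S

/-- **the selection words `μ_B` span exactly the span of the pair-free block-`D` `n`-monomials.** -/
theorem span_wordsD_eq_Sp :
    Submodule.span K (Set.range fun S : Finset (Fin n) => (List.ofFn fun k : Fin n =>
      ι K (if k ∈ S then b K (In (n + n)) (yJ (n + n) (Fin.castAdd n k)) else b K (In (n + n)) (xJ (n + n) (Fin.castAdd n k)))).prod) =
      Sp K (fun t : Finset (In (n + n)) => t ⊆ Dm (n + n) n ∧ t.card = n ∧ ¬ ∃ i ∈ t, pt i ∈ t) := by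
  classical
  apply Submodule.eq_of_le_of_finrank_eq
  · rw [Submodule.span_le]
    rintro _ ⟨S, rfl⟩
    obtain ⟨c, -, h⟩ := wordP_eq_smul_B (K := K) S
    dsimp only
    rw [h]
    exact Submodule.smul_mem _ _ (B_mem_Sp (letterD_selD S))
  · rw [finrank_span_eq_card linearIndependent_wordsD, finrank_Sp, card_selD, Fintype.card_finset, Fintype.card_fin]

/-- **the selection words `μ′_{B′}` span exactly the span of the pair-free block-`G` `n`-monomials.** -/
theorem span_wordsG_eq_Sp :
    Submodule.span K (Set.range fun S : Finset (Fin n) => (List.ofFn fun k : Fin n =>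
      ι K (if k ∈ S then b K (In (n + n)) (yJ (n + n) (Fin.natAdd n k)) else b K (In (n + n)) (xJ (n + n) (Fin.natAdd n k)))).prod) =
      Sp K (fun t : Finset (In (n + n)) => t ⊆ Gm (n + n) n ∧ t.card = n ∧ ¬ ∃ i ∈ t, pt i ∈ t) := by
  classical
  apply Submodule.eq_of_le_of_finrank_eq
  · rw [Submodule.span_le]
    rintro _ ⟨S, rfl⟩
    obtain ⟨c, -, h⟩ := wordQ_eq_smul_B (K := K) S
    dsimp only
    rw [h]
    exact Submodule.smul_mem _ _ (B_mem_Sp (letterG_selG S))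
  · rw [finrank_span_eq_card linearIndependent_wordsG, finrank_Sp, card_selG, Fintype.card_finset, Fintype.card_fin]

/-! ### §3 The decomposition of `⋀ⁿ` by support type -/

/-- **`⋀ⁿ = Mm_n ⊔ (pairD ⊔ (pairG ⊔ (selD ⊔ selG)))`** in th-7's Weil model of type `(n,n)`. -/
theorem Hom_middle_eq_sup (n : ℕ) :
    Hom K (In (n + n)) Finset.univ n =
      Mm K (n + n) n n ⊔
      (Sp K (fun t : Finset (In (n + n)) => t ⊆ Dm (n + n) n ∧ t.card = n ∧ ∃ i ∈ t, pt i ∈ t) ⊔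
      (Sp K (fun t : Finset (In (n + n)) => t ⊆ Gm (n + n) n ∧ t.card = n ∧ ∃ i ∈ t, pt i ∈ t) ⊔
      (Sp K (fun t : Finset (In (n + n)) => t ⊆ Dm (n + n) n ∧ t.card = n ∧ ¬ ∃ i ∈ t, pt i ∈ t) ⊔
       Sp K (fun t : Finset (In (n + n)) => t ⊆ Gm (n + n) n ∧ t.card = n ∧ ¬ ∃ i ∈ t, pt i ∈ t)))) := by
  rw [Hom_univ_eq_Sp, Mm, ← Sp_or, ← Sp_or, ← Sp_or, ← Sp_or]
  apply Sp_congr_iff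
  intro t
  simp only [Degm, Mixm, Finset.subset_univ, true_and]
  constructor
  · intro ht
    by_cases hD : t ⊆ Dm (n + n) n
    · by_cases hp : ∃ i ∈ t, pt i ∈ t
      · exact Or.inr (Or.inl ⟨hD, ht, hp⟩)
      · exact Or.inr (Or.inr (Or.inr (Or.inl ⟨hD, ht, hp⟩)))
    · by_cases hG : t ⊆ Gm (n + n) n
      · by_cases hp : ∃ i ∈ t, pt i ∈ t
        · exact Or.inr (Or.inr (Or.inl ⟨hG, ht, hp⟩))
        · exact Or.inr (Or.inr (Or.inr (Or.inr ⟨hG, ht, hp⟩)))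
      · exact Or.inl ⟨ht, hD, hG⟩
  · rintro (h | h | h | h | h)
    · exact h.1
    · exact h.2.1
    · exact h.2.1
    · exact h.2.1
    · exact h.2.1

end Summit.Ventures.HSemireg.Mod4Site
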